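import Mathlib.Analysis.Normed.Ring.InfiniteSum
import Mathlib.Analysis.RCLike.Basic
import HarnessLib

/-!
# Finite products of absolutely convergent series: `∏_{i<k} Σ_n f_i(n) = Σ_{x : Fin k → ℕ} ∏_i f_i(x_i)`

HONEST FRAMING: exact (Metropolis-corrected) sampling algorithms for lattice gauge theory;
figures of merit are autocorrelation/cost numbers at stated couplings and volumes; no
continuum-physics claim.

Venture `LatticeQCDFlow` (cell pub-lqcd), sub-topic `Scoring`; FANOUT row 5 (`s0-sun-a`), GEN-9.
NEW WORK of the cell (placement rule).  Bookkeeping for the LATTICE ASSEMBLY (step 6) of row 5's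
route to the exact SU(2) torus formula: expanding the product over the `F` plaquettes of the
per-plaquette character series `Σ_n c_n χ_n(U_p)` (`SU2PlaquetteCharacterSeries`) into ONE absolutely
convergent series over multi-indices `ℕ^F`, so that the Haar integral over `G^E` can be exchanged
with the sum (dominated convergence with `Σ_x ∏_p (n_p+1) c_{n_p} = (Σ_n (n+1)c_n)^F < ∞`).

* `summable_norm_prod_pi_and_tsum` — for `f : Fin k → ℕ → R` (complete normed commutative ring)
  with every `Σ_n ‖f_i(n)‖ < ∞`: the multi-series `x ↦ ∏_i f_i(x_i)` on `Fin k → ℕ` is absolutely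
  summable and `Σ'_x ∏_i f_i(x_i) = ∏_i Σ'_n f_i(n)` (induction on `k` through `Fin.consEquiv` and
  `tsum_mul_tsum_of_summable_norm`); corollaries `summable_prod_pi`, `tsum_prod_pi_eq_prod_tsum`.

Mathlib has the binary case (`tsum_mul_tsum_of_summable_norm`) and finite sums (`Finset.prod_sum`),
not this finite-product-of-series form.  No new definition; nothing cited.
-/

open Finset

namespace Summit.Ventures.LatticeQCDFlow.Scoring

variable {R : Type*} [NormedCommRing R] [CompleteSpace R]

/-- **Finite products of absolutely convergent series.**  For `f : Fin k → ℕ → R` with each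
`Σ_n ‖f i n‖ < ∞`: `x ↦ ∏_i f i (x i)` is absolutely summable on `Fin k → ℕ` and
`Σ'_x ∏_i f i (x i) = ∏_i Σ'_n f i n`. -/
theorem summable_norm_prod_pi_and_tsum :
    ∀ (k : ℕ) (f : Fin k → ℕ → R), (∀ i, Summable fun n => ‖f i n‖) →
      (Summable fun x : Fin k → ℕ => ‖∏ i, f i (x i)‖) ∧
        ∑' x : Fin k → ℕ, ∏ i, f i (x i) = ∏ i, ∑' n, f i n := by
  intro k
  induction k with
  | zero =>
    intro f _
    refine ⟨(hasSum_fintype _).summable, ?_⟩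
    rw [tsum_fintype]
    simp
  | succ k ih =>
    intro f hf
    -- split off the first coordinate along `Fin.consEquiv : ℕ × (Fin k → ℕ) ≃ (Fin (k+1) → ℕ)`
    obtain ⟨ihs, iht⟩ := ih (fun i => f i.succ) (fun i => hf i.succ)
    have hsplit : ∀ (a : ℕ) (y : Fin k → ℕ),
        ∏ i : Fin (k + 1), f i (Fin.cons (α := fun _ : Fin (k + 1) => ℕ) a y i) =
          f 0 a * ∏ i : Fin k, f i.succ (y i) := by
      intro a y
      rw [Fin.prod_univ_succ, Fin.cons_zero]
      congr 1
    have hnorm : Summable fun z : ℕ × (Fin k → ℕ) => ‖f 0 z.1 * ∏ i : Fin k, f i.succ (z.2 i)‖ :=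
      (hf 0).mul_norm (g := fun y : Fin k → ℕ => ∏ i : Fin k, f i.succ (y i)) ihs
    have hprod := tsum_mul_tsum_of_summable_norm (f := f 0)
      (g := fun y : Fin k → ℕ => ∏ i : Fin k, f i.succ (y i)) (hf 0) ihs
    refine ⟨?_, ?_⟩
    · rw [← (Fin.consEquiv fun _ : Fin (k + 1) => ℕ).summable_iff]
      refine hnorm.congr fun z => ?_
      simp only [Function.comp_apply, Fin.consEquiv_apply, hsplit]
    · rw [← (Fin.consEquiv fun _ : Fin (k + 1) => ℕ).tsum_eq]
      have e2 : (fun z : ℕ × (Fin k → ℕ) => ∏ i : Fin (k + 1),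
          f i ((Fin.consEquiv fun _ : Fin (k + 1) => ℕ) z i)) =
          fun z => f 0 z.1 * ∏ i : Fin k, f i.succ (z.2 i) := by
        funext z
        simp only [Fin.consEquiv_apply, hsplit]
      rw [e2, ← hprod, iht, Fin.prod_univ_succ]

/-- The multi-series `x ↦ ∏_i f i (x i)` is summable. -/
theorem summable_prod_pi {k : ℕ} (f : Fin k → ℕ → R) (hf : ∀ i, Summable fun n => ‖f i n‖) :
    Summable fun x : Fin k → ℕ => ∏ i, f i (x i) :=
  (summable_norm_prod_pi_and_tsum k f hf).1.of_norm

/-- **`Σ'_{x : Fin k → ℕ} ∏_i f i (x i) = ∏_i Σ'_n f i n`.** -/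
theorem tsum_prod_pi_eq_prod_tsum {k : ℕ} (f : Fin k → ℕ → R) (hf : ∀ i, Summable fun n => ‖f i n‖) :
    ∑' x : Fin k → ℕ, ∏ i, f i (x i) = ∏ i, ∑' n, f i n :=
  (summable_norm_prod_pi_and_tsum k f hf).2

/-- Real nonnegative version: for `0 ≤ a i n` with each `Σ_n a i n < ∞`,
`Σ'_x ∏_i a i (x i) = ∏_i Σ'_n a i n` and the multi-series is summable. -/
theorem tsum_prod_pi_eq_prod_tsum_of_nonneg {k : ℕ} (a : Fin k → ℕ → ℝ) (ha : ∀ i n, 0 ≤ a i n)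
    (hs : ∀ i, Summable (a i)) :
    Summable (fun x : Fin k → ℕ => ∏ i, a i (x i)) ∧
      ∑' x : Fin k → ℕ, ∏ i, a i (x i) = ∏ i, ∑' n, a i n := by
  have hn : ∀ i, Summable fun n => ‖a i n‖ := fun i =>
    (hs i).congr fun n => by rw [Real.norm_eq_abs, abs_of_nonneg (ha i n)]
  exact ⟨summable_prod_pi a hn, tsum_prod_pi_eq_prod_tsum a hn⟩

end Summit.Ventures.LatticeQCDFlow.Scoring
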